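import Literature.Analysis.FluidPDE.PineauVicolRSSChaeWolf
import Literature.Analysis.FluidPDE.IsometryInvariance
import Literature.Analysis.FluidPDE.AncientSimilarityVariables
import Literature.Analysis.FluidPDE.AxisymmetricVorticityTransport
import Literature.Analysis.FluidPDE.PineauVicolRSSProofs
import HarnessLib

/-!
# The RDSS ansatz in the rotation-free Leray frame (Pineau–Vicol 2026, Theorem 1.7: the dictionary)

Analysis/FluidPDE support file (all results proved; no named facts) in the discharge programme of
`Literature.Analysis.FluidPDE.pineauVicol2026_rdss_liouville` (B. Pineau, V. Vicol,
arXiv:2607.09619 (2026), Thm. 1.7). The source works with the rotating-frame profile `U(y, s)`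
of the RDSS ansatz (1.13a), `u(x,t) = (−t)^{−1/2} R(αs) U(R(−αs)x/√(−t), s)`, `s = −log(−t)`,
periodic in `s`. The tree's backward similarity variables (`lerayOrbit`,
`IsBackwardLeraySolutionOn`, files `AncientSimilarityVariables` / `AncientSimilarityVorticity`)
carry no rotation; the two profiles differ by a rigid rotation, `V(s,y) = R(αs) U(R(−αs)y, s)`
(`lerayOrbit_pvAnsatz`), so that every rotation-invariant quantity of the source's §7 (slice
norms, enstrophies, the stretching integral) may be computed in the `V`-frame, where the
vorticity equation is the tree's `IsBackwardLeraySolutionOn.vorticity_eq` (used in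
`PineauVicolEnstrophy`).

* `isRotatedDSS_pvAnsatz`: a `2 log c`-periodic profile makes the ansatz field rotated discretely
  self-similar, `c R⁻¹ u(c²t, cRx) = u(t,x)` with `R = R(−α·2 log c)` (the tree's `IsRotatedDSS`;
  Remark 1.5 / (1.13) of the source).
* `exists_isClassicalNSSolutionOn_Iio_of_isRotatedDSS`: **footnote 21** — a classical solution on
  `[−1, 0)` whose velocity is rotated-DSS extends (same velocity, a normalised pressure) to a
  classical solution on `(−∞, 0)` (scaling + rotation covariance of the equations and the tree's
  pressure patching `IsClassicalNSSolutionOn.exists_pressure_Iio_of_Ioo`).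
* `lerayOrbit_pvAnsatz`, `norm_lerayOrbit_pvAnsatz_le` (the profile bound (1.9) in the
  `V`-frame), `profile_eq_zero_of_lerayOrbit_pvAnsatz_eq_zero` (`V(s) ≡ 0 ⇒ U(·,s) ≡ 0`).
* `exists_isBackwardLeraySolutionOn_of_rdss`: under the hypotheses of Theorem 1.7, `V` solves the
  backward Leray system on `ℝ × ℝ³` with some pressure, `|V(s,y)| ≤ C₀/(1+|y|)`, and
  `V(s + 2 log c) = R(α·2 log c) V(s, R(−α·2 log c)·)` (twisted periodicity).

## References

* B. Pineau, V. Vicol, arXiv:2607.09619 (2026): (1.13), Remark 1.5, Lemma 7.1, §7.1 footnote 21.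
  [PineauVicol2026]
* D. Chae, J. Wolf, Comm. PDE 42 (2017), §4 (similarity variables for DSS solutions).
  [ChaeWolf2017RemovingDSS]
-/

noncomputable section

open Set Filter Function MeasureTheory
open scoped Topology

namespace Literature.Analysis.FluidPDE

namespace PineauVicol2026

/-- Local notation for physical space `ℝ³ = EuclideanSpace ℝ (Fin 3)`. -/
local notation "ℝ³" => EuclideanSpace ℝ (Fin 3)

/-- **The RDSS ansatz field is rotated discretely self-similar.** For a profile `U` which is
`2 log c`-periodic in `s` (`c > 0`), the ansatz field `u = pvAnsatz α U` of (1.13a) satisfies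
`c R⁻¹ u(c²t, c R x) = u(t, x)` for all `t`, `x` with the fixed rotation `R = R(−α·2 log c)`
(for `t ≥ 0` both sides are the junk value `0`): `s(c²t) = s(t) − 2 log c`, `√(−c²t) = c√(−t)`,
`R(α(s − S)) = R(αs) R(−αS)`. [cite: PineauVicol2026, (1.13) and Remark 1.5] -/
theorem isRotatedDSS_pvAnsatz {α c : ℝ} (hc : 0 < c) {U : ℝ³ → ℝ → ℝ³}
    (hper : ∀ (y : ℝ³) (s : ℝ), U y (s + 2 * Real.log c) = U y s) :
    IsRotatedDSS c (rotZLIE (-(α * (2 * Real.log c)))) (pvAnsatz α U) := by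
  have hzs : ∀ (θ a : ℝ) (z : ℝ³), rotZ θ (a • z) = a • rotZ θ z := fun θ a z => by
    rw [← rotZL_apply, map_smul, rotZL_apply]
  intro t x
  by_cases ht : t < 0
  · have hnt : 0 < -t := by linarith
    have hs : 0 < Real.sqrt (-t) := Real.sqrt_pos.2 hnt
    have hsqrt : Real.sqrt (-(c ^ 2 * t)) = c * Real.sqrt (-t) := by
      rw [show -(c ^ 2 * t) = c ^ 2 * (-t) by ring, Real.sqrt_mul (sq_nonneg c), Real.sqrt_sq hc.le]
    have hlog : -Real.log (-(c ^ 2 * t)) = -Real.log (-t) - 2 * Real.log c := by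
      rw [show -(c ^ 2 * t) = c ^ 2 * (-t) by ring, Real.log_mul (by positivity) hnt.ne', Real.log_pow]
      push_cast; ring
    have hper' : ∀ y, U y (-Real.log (-t) - 2 * Real.log c) = U y (-Real.log (-t)) := fun y => by
      have := hper y (-Real.log (-t) - 2 * Real.log c); rw [sub_add_cancel] at this; exact this.symm
    simp only [pvAnsatz, rotZLIE_symm_apply, rotZLIE_apply, neg_neg]
    rw [hsqrt, hlog]
    -- abbreviations
    set s : ℝ := -Real.log (-t) with hsdef
    set S : ℝ := 2 * Real.log c with hSdef
    set r : ℝ := Real.sqrt (-t) with hrdef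
    have hcr : (c * r)⁻¹ * c = r⁻¹ := by field_simp
    have hcr' : c * (c * r)⁻¹ = r⁻¹ := by field_simp
    have e2 : -(α * (s - S)) + -(α * S) = -(α * s) := by ring
    have e3 : α * S + α * (s - S) = α * s := by ring
    rw [smul_smul ((c * r)⁻¹) c, hcr, ← hzs (-(α * S)) r⁻¹ x, ← rotZ_add (-(α * (s - S))) (-(α * S)), e2,
      hper', hzs (α * S) (c * r)⁻¹, smul_smul c ((c * r)⁻¹), hcr', ← rotZ_add (α * S) (α * (s - S)), e3]
  · have ht' : 0 ≤ t := not_lt.1 ht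
    rw [pvAnsatz_of_nonneg _ _ (mul_nonneg (sq_nonneg c) ht'), pvAnsatz_of_nonneg _ _ ht', map_zero, smul_zero]

/-! ### Backward extension of a classical RDSS solution (footnote 21 of the source) -/

section Extension

variable {E : Type*} [NormedAddCommGroup E] [InnerProductSpace ℝ E] [FiniteDimensional ℝ E]

/-- A classical solution stays classical when the velocity is replaced by a field with the same
slices on the time set (private copy of the tree's `IsClassicalNSSolutionOn.congr_velocity`, light
import). [folklore] -/
private theorem congr_velocity' {S : Set ℝ} {ν : ℝ}
    {f u v : ℝ → E → E} {p : ℝ → E → ℝ} (h : IsClassicalNSSolutionOn S ν f u p)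
    (huv : ∀ t ∈ S, v t = u t) :
    IsClassicalNSSolutionOn S ν f v p where
  smooth_velocity :=
    h.smooth_velocity.congr fun z hz => by
      change v z.1 z.2 = u z.1 z.2
      rw [huv z.1 (mem_prod.1 hz).1]
  smooth_pressure := h.smooth_pressure
  momentum t ht x := by
    have h1 : timeDerivWithin S v t x = timeDerivWithin S u t x := by
      simp only [timeDerivWithin]
      exact derivWithin_congr (fun s hs => by rw [huv s hs]) (by rw [huv t ht])
    rw [h1, huv t ht]
    exact h.momentum t ht x
  divFree t ht := by
    rw [huv t ht]
    exact h.divFree t ht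

omit [FiniteDimensional ℝ E] in
/-- The inverse form of rotated discrete self-similarity: `v(t, z) = c⁻¹ R (v (c⁻²t) (c⁻¹ R⁻¹ z))`,
i.e. `v = nsRescale c⁻¹ (R v R⁻¹)` — the form that expresses `v` at a time through a *later*
(less negative) time. [folklore] -/
theorem IsRotatedDSS.eq_nsRescale_inv_conj {c : ℝ} {R : E ≃ₗᵢ[ℝ] E} {v : ℝ → E → E}
    (h : IsRotatedDSS c R v) (hc : c ≠ 0) :
    nsRescale c⁻¹ (fun t x => R (v t (R.symm x))) = v := by
  funext t z
  rw [nsRescale_apply]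
  have key := h (c⁻¹ ^ 2 * t) (c⁻¹ • R.symm z)
  rw [show c ^ 2 * (c⁻¹ ^ 2 * t) = t by field_simp, map_smul, smul_smul, mul_inv_cancel₀ hc, one_smul,
    LinearIsometryEquiv.apply_symm_apply] at key
  -- `key : c • R.symm (v t z) = v (c⁻²t) (c⁻¹ R⁻¹ z)`
  rw [LinearIsometryEquiv.map_smul, ← key, LinearIsometryEquiv.map_smul, LinearIsometryEquiv.apply_symm_apply,
    smul_smul, inv_mul_cancel₀ hc, one_smul]

/-- **Backward extension of a classical rotated-DSS solution (footnote 21 of the source).** Let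
`(u, p)` be a classical solution of Navier–Stokes (`ν = 1`, `f = 0`) on `[−1, 0)` whose velocity
agrees there with a field `v` which is rotated discretely self-similar with factor `c > 1` and a
linear isometry `R` (`c R⁻¹ v(c²t, cRx) = v(t,x)`). Then `v` is a classical solution on
`(−∞, 0)` for some pressure: on `(−c^{2k}, 0)` it is the `k`-fold rescaled–rotated copy
`c⁻¹ R (·) (c⁻²·, c⁻¹R⁻¹·)` of `u` (scaling and rotation covariance,
`IsClassicalNSSolutionOn.nsRescale_holds`, `.conj_linearIsometryEquiv`), and the pressures patch
after normalisation (`IsClassicalNSSolutionOn.exists_pressure_Iio_of_Ioo`). [cite: PineauVicol2026, §7.1 footnote 21] -/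
theorem exists_isClassicalNSSolutionOn_Iio_of_isRotatedDSS {u v : ℝ → E → E} {p : ℝ → E → ℝ}
    {c : ℝ} {R : E ≃ₗᵢ[ℝ] E} (hsol : IsClassicalNSSolutionOn (Ico (-1) 0) 1 0 u p) (hc : 1 < c)
    (hdss : IsRotatedDSS c R v) (huv : ∀ t ∈ Ico (-1 : ℝ) 0, ∀ x : E, u t x = v t x) :
    ∃ P : ℝ → E → ℝ, IsClassicalNSSolutionOn (Iio 0) 1 0 v P := by
  have hc0 : 0 < c := zero_lt_one.trans hc
  have hinv : 0 < c⁻¹ := inv_pos.2 hc0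
  -- the pieces, by induction on `k`
  have hpiece : ∀ k : ℕ, ∃ q : ℝ → E → ℝ, IsClassicalNSSolutionOn (Ioo (-(c ^ k) ^ 2) 0) 1 0 v q := by
    intro k
    induction k with
    | zero =>
        refine ⟨p, congr_velocity' (hsol.mono (fun t ht => ?_) (uniqueDiffOn_Ioo _ _)) fun t ht => ?_⟩
        · simpa using Ioo_subset_Ico_self ht
        · funext x; exact (huv t (by simpa using Ioo_subset_Ico_self ht) x).symm
    | succ k ih =>
        obtain ⟨q, hq⟩ := ih
        -- rotate, then rescale by `c⁻¹`
        have h1 := hq.conj_linearIsometryEquiv (R := R) (uniqueDiffOn_Ioo _ _)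
        have h2 := IsClassicalNSSolutionOn.nsRescale_holds h1 hinv
        have hf : nsRescaleForce c⁻¹ (fun t x => R ((0 : ℝ → E → E) t (R.symm x))) = 0 := by
          funext t x; simp [nsRescaleForce_apply]
        have hS : ((fun t => c⁻¹ ^ 2 * t) ⁻¹' Ioo (-(c ^ k) ^ 2) (0 : ℝ)) = Ioo (-(c ^ (k + 1)) ^ 2) 0 := by
          ext t
          simp only [mem_preimage, mem_Ioo]
          have hck : (0 : ℝ) < (c ^ k) ^ 2 := by positivity
          have hc2 : (0 : ℝ) < c⁻¹ ^ 2 := by positivity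
          constructor
          · rintro ⟨ha, hb⟩
            refine ⟨?_, by nlinarith⟩
            have : -(c ^ k) ^ 2 * c ^ 2 < t := by
              have := mul_lt_mul_of_pos_right ha (show (0:ℝ) < c ^ 2 by positivity)
              rwa [show c⁻¹ ^ 2 * t * c ^ 2 = t by field_simp] at this
            calc -(c ^ (k + 1)) ^ 2 = -(c ^ k) ^ 2 * c ^ 2 := by ring
              _ < t := this
          · rintro ⟨ha, hb⟩
            refine ⟨?_, mul_neg_of_pos_of_neg hc2 hb⟩
            have : -(c ^ (k + 1)) ^ 2 * c⁻¹ ^ 2 < t * c⁻¹ ^ 2 := mul_lt_mul_of_pos_right ha hc2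
            calc -(c ^ k) ^ 2 = -(c ^ (k + 1)) ^ 2 * c⁻¹ ^ 2 := by field_simp; ring
              _ < t * c⁻¹ ^ 2 := this
              _ = c⁻¹ ^ 2 * t := mul_comm _ _
        rw [hf, hS, IsRotatedDSS.eq_nsRescale_inv_conj hdss hc0.ne'] at h2
        exact ⟨_, h2⟩
  choose q hq using hpiece
  refine IsClassicalNSSolutionOn.exists_pressure_Iio_of_Ioo hq fun t ht => ?_
  obtain ⟨n, hn⟩ := pow_unbounded_of_one_lt (-t) hc
  refine ⟨n, ?_⟩
  have h1 : (1 : ℝ) ≤ c ^ n := one_le_pow₀ hc.le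
  have h2 : c ^ n ≤ (c ^ n) ^ 2 := by nlinarith
  linarith

end Extension

/-! ### The Leray orbit of the RDSS ansatz field: `V(s, y) = R(αs) U(R(−αs) y, s)` -/

/-- **The α-free profile.** The profile of the RDSS ansatz field `u = pvAnsatz α U` in the tree's
backward similarity variables (`lerayOrbit`, no rotation) is the rotation-conjugate of the
source's profile: `V(s, y) = R(αs) U(R(−αs) y, s)` (`√(−t) = e^{−s/2}`, `−log(−t) = s` at
`t = −e^{−s}`). [cite: PineauVicol2026, (1.13a)] -/
theorem lerayOrbit_pvAnsatz (α : ℝ) (U : ℝ³ → ℝ → ℝ³) (s : ℝ) (y : ℝ³) :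
    lerayOrbit (pvAnsatz α U) s y = rotZ (α * s) (U (rotZ (-(α * s)) y) s) := by
  have hzs : ∀ (θ a : ℝ) (z : ℝ³), rotZ θ (a • z) = a • rotZ θ z := fun θ a z => by
    rw [← rotZL_apply, map_smul, rotZL_apply]
  rw [lerayOrbit_apply]
  have hsq : Real.sqrt (Real.exp (-s)) = Real.exp (-s / 2) := by
    rw [← exp_neg_half_sq, Real.sqrt_sq (Real.exp_pos _).le]
  have hpos : Real.exp (-s / 2) ≠ 0 := (Real.exp_pos _).ne'
  simp only [pvAnsatz, neg_neg, hsq, Real.log_exp, smul_smul, inv_mul_cancel₀ hpos, one_smul,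
    mul_inv_cancel₀ hpos]

/-- **Rotation invariance of slice norms**: `‖V(s, y)‖ = ‖U(R(−αs)y, s)‖`, so the profile bound
(1.9) for `U` is the same bound for `V`: `|V(s,y)| ≤ C₀/(1+|y|)`. [folklore] -/
theorem norm_lerayOrbit_pvAnsatz_le {α C₀ : ℝ} {U : ℝ³ → ℝ → ℝ³}
    (hU : ∀ (y : ℝ³) (s : ℝ), ‖U y s‖ ≤ C₀ / (1 + ‖y‖)) (s : ℝ) (y : ℝ³) :
    ‖lerayOrbit (pvAnsatz α U) s y‖ ≤ C₀ / (1 + ‖y‖) := by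
  rw [lerayOrbit_pvAnsatz, norm_rotZ]
  simpa [norm_rotZ] using hU (rotZ (-(α * s)) y) s

/-- The profile `V` vanishes iff `U` does (slice by slice). [folklore] -/
theorem profile_eq_zero_of_lerayOrbit_pvAnsatz_eq_zero {α : ℝ} {U : ℝ³ → ℝ → ℝ³} {s : ℝ}
    (h : ∀ y, lerayOrbit (pvAnsatz α U) s y = 0) (y : ℝ³) : U y s = 0 := by
  have := h (rotZ (α * s) y)
  rw [lerayOrbit_pvAnsatz, ← rotZ_add, neg_add_cancel, rotZ_zero] at this
  -- `rotZ (αs) (U y s) = 0`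
  have h2 := congrArg (rotZ (-(α * s))) this
  rwa [← rotZ_add, neg_add_cancel, rotZ_zero, ← rotZL_apply (-(α * s)) 0, map_zero] at h2

/-! ### From the hypotheses of Theorem 1.7 to the α-free Leray frame -/

/-- **The RDSS data in the Leray frame.** Under the hypotheses of
`pineauVicol2026_rdss_liouville` (classical solution on `[−1, 0)`, Type I bound with constant
`C₀`, RDSS ansatz with a `2 log c`-periodic profile `U`, `c > 1`), the rotation-free profile
`V = lerayOrbit (pvAnsatz α U)` (`V(s,y) = R(αs)U(R(−αs)y, s)`) solves the backward Leray system
on all of `ℝ × ℝ³` with some pressure, obeys `|V(s,y)| ≤ C₀/(1 + |y|)` for all `s, y`, and is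
twisted-periodic: `V(s + 2 log c, y) = R(α·2 log c) V(s, R(−α·2 log c) y)`. [cite: PineauVicol2026, Lemma 7.1 and §7.1 footnote 21] -/
theorem exists_isBackwardLeraySolutionOn_of_rdss {α c C₀ : ℝ} (hc : 1 < c)
    {u : ℝ → ℝ³ → ℝ³} {p : ℝ → ℝ³ → ℝ} {U : ℝ³ → ℝ → ℝ³}
    (hsol : IsClassicalNSSolutionOn (Ico (-1) 0) 1 0 u p)
    (hI : ∀ t ∈ Ico (-1 : ℝ) 0, ∀ x, ‖u t x‖ ≤ C₀ / (‖x‖ + Real.sqrt (-t)))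
    (hper : ∀ (y : ℝ³) (s : ℝ), U y (s + 2 * Real.log c) = U y s)
    (hA : ∀ t ∈ Ico (-1 : ℝ) 0, ∀ x, u t x = pvAnsatz α U t x) :
    ∃ P : ℝ → ℝ³ → ℝ,
      IsBackwardLeraySolutionOn univ 1 (lerayOrbit (pvAnsatz α U)) P ∧
      (∀ (s : ℝ) (y : ℝ³), ‖lerayOrbit (pvAnsatz α U) s y‖ ≤ C₀ / (1 + ‖y‖)) ∧
      (∀ (s : ℝ) (y : ℝ³), lerayOrbit (pvAnsatz α U) (s + 2 * Real.log c) y =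
        rotZ (α * (2 * Real.log c)) (lerayOrbit (pvAnsatz α U) s (rotZ (-(α * (2 * Real.log c))) y))) := by
  have hc0 : 0 < c := zero_lt_one.trans hc
  have hdss := isRotatedDSS_pvAnsatz (α := α) hc0 hper
  obtain ⟨P, hP⟩ := exists_isClassicalNSSolutionOn_Iio_of_isRotatedDSS hsol hc hdss hA
  refine ⟨lerayOrbitPressure P, isClassicalNSSolutionOn_Iio_iff_isBackwardLeraySolutionOn.1 hP,
    norm_lerayOrbit_pvAnsatz_le (norm_profile_le_of_typeI_periodic hc hI hper hA), fun s y => ?_⟩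
  have h := IsRotatedDSS.lerayOrbit_add_period hdss hc0 s y
  rw [h, rotZLIE_symm_apply, rotZLIE_apply, neg_neg]

end PineauVicol2026

end Literature.Analysis.FluidPDE
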